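import Literature.Combinatorics.Hypergraph.ContainersIterated
import Literature.Combinatorics.SimpleGraph.ArrowsCliques
import Mathlib.Combinatorics.SimpleGraph.Finite
import Mathlib.Combinatorics.SimpleGraph.Maps
import Mathlib.Data.Fintype.CardEmbedding
import Mathlib.Data.Finset.Sort
import Mathlib.Logic.Embedding.Set
import Mathlib.Data.Nat.Choose.Bounds
import Mathlib.Analysis.SpecialFunctions.Pow.Real
import HarnessLib

/-!
# The copy hypergraph of a graph `F` in `K_n`: uniformity, size, co-degrees via the 2-density

Nenadov–Steger (CPC 2016, §2, Thm. 5) apply the hypergraph container theorem to the `e_F`-uniform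
hypergraph whose vertices are the edges of `K_n` and whose hyperedges are the edge sets of the
copies of a fixed graph `F` in `K_n`. This file sets up that hypergraph for a graph `F` on `Fin k`
WITHOUT ISOLATED VERTICES (the general case is reduced to this one where the random Ramsey theorem
is assembled) and proves the three counting facts the container/sparsification machinery
(`Literature/Combinatorics/Hypergraph/`) consumes:

* `copyH_subset_powersetCard` — every copy is an `e_F`-subset of the set `pairsX n` of pairs
  (edges of `K_n`);
* `choose_le_card_copyH` — there are at least `C(n, k)` copies (distinct vertex sets give
  distinct copies, as `F` has no isolated vertices);
* `hdeg_copyH_le_rpow` — **the co-degree bound via `m₂`**: a set `u` of `ℓ ≥ 1` pairs lies in at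
  most `k^k · n^{k - 2 - (ℓ-1)/m₂(F)}` copies. Indeed a copy through `u` has all `s` vertices
  touched by `u` among its `k` vertices (`≤ C(n-s, k-s) · k! ≤ k^k n^{k-s}` copies,
  `hdeg_copyH_le`), and pulling `u` back to `F` exhibits `s` vertices of `F` spanning `≥ ℓ`
  edges, so `m₂(F) ≥ (ℓ-1)/(s-2)`, i.e. `s ≥ 2 + (ℓ-1)/m₂(F)` (`le_card_verts`). This is exactly
  the verification of the co-degree condition `Δ_ℓ ≤ c τ^{ℓ-1} e(H)/v(H)` at `τ = n^{-1/m₂(F)}`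
  (Balogh–Morris–Samotij survey §3; Nenadov–Steger use Saxton–Thomason's version).

All statements are theorems; no named facts.

## References

* R. Nenadov, A. Steger, *A short proof of the random Ramsey theorem*, CPC 25 (2016), §2
  (Def. 4, Thm. 5). [NenadovSteger2014]
* J. Balogh, R. Morris, W. Samotij, *The method of hypergraph containers*, Proc. ICM 2018, §3.
  [BaloghMorrisSamotij2019]
-/

namespace Literature.Combinatorics.SimpleGraph

open Finset Literature.Combinatorics.Hypergraph
open _root_.SimpleGraph

variable {k : ℕ} (F : _root_.SimpleGraph (Fin k)) [DecidableRel F.Adj]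

/-! ### The ground set and the copies -/

/-- The pairs of distinct vertices of `Fin n` (the edge set of `K_n`), as a finset of `Sym2`.
[folklore] -/
def pairsX (n : ℕ) : Finset (Sym2 (Fin n)) := univ.filter fun e => ¬ e.IsDiag

/-- Membership in `pairsX`. [folklore] -/
theorem mem_pairsX {n : ℕ} {e : Sym2 (Fin n)} : e ∈ pairsX n ↔ ¬ e.IsDiag := by
  simp [pairsX]

/-- `|pairsX n| = C(n, 2)`. [folklore] -/
theorem card_pairsX (n : ℕ) : #(pairsX n) = n.choose 2 := by
  rw [pairsX, ← Fintype.card_subtype, Sym2.card_subtype_not_diag, Fintype.card_fin]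

/-- The copy of `F` along an embedding `φ : Fin k ↪ Fin n`: the image of the edge set of `F`
(the edge set of the graph `F.map φ`). [cite: NenadovSteger2014, §2 (Thm. 5: copies of F in K_n)] -/
def copyMap (n : ℕ) (φ : Fin k ↪ Fin n) : Finset (Sym2 (Fin n)) := F.edgeFinset.map φ.sym2Map

/-- **The copy hypergraph** `H_n(F)`: the edge sets of all copies of `F` in `K_n`, an
`e_F`-uniform family on `pairsX n` whose independent sets are exactly the `F`-free graphs.
[cite: NenadovSteger2014, §2 (Thm. 5 and the remark after it)] -/
noncomputable def copyH (n : ℕ) : Finset (Finset (Sym2 (Fin n))) := univ.image (copyMap F n)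

variable {F}

/-- Membership in a copy. [folklore] -/
theorem mem_copyMap {n : ℕ} {φ : Fin k ↪ Fin n} {x : Sym2 (Fin n)} :
    x ∈ copyMap F n φ ↔ ∃ e ∈ F.edgeFinset, φ.sym2Map e = x := by
  rw [copyMap, mem_map]

/-- Membership in the copy hypergraph. [folklore] -/
theorem mem_copyH {n : ℕ} {e : Finset (Sym2 (Fin n))} :
    e ∈ copyH F n ↔ ∃ φ : Fin k ↪ Fin n, copyMap F n φ = e := by
  simp [copyH]

/-- A copy has `e_F` pairs. [folklore] -/
theorem card_copyMap (n : ℕ) (φ : Fin k ↪ Fin n) : #(copyMap F n φ) = #F.edgeFinset :=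
  card_map _

/-- Copies consist of pairs of distinct vertices. [folklore] -/
theorem copyMap_subset_pairsX (n : ℕ) (φ : Fin k ↪ Fin n) : copyMap F n φ ⊆ pairsX n := by
  intro x hx
  rw [mem_copyMap] at hx
  obtain ⟨e, he, rfl⟩ := hx
  rw [mem_pairsX]
  rw [mem_edgeFinset] at he
  have hnd := not_isDiag_of_mem_edgeSet F he
  induction e using Sym2.ind with
  | _ a b =>
    rw [Function.Embedding.sym2Map_apply, Sym2.map_mk, Sym2.mk_isDiag_iff]
    rw [Sym2.mk_isDiag_iff] at hnd
    exact fun h => hnd (φ.injective h)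

/-- **Uniformity**: `H_n(F)` is a family of `e_F`-subsets of `pairsX n`. [folklore] -/
theorem copyH_subset_powersetCard (n : ℕ) :
    copyH F n ⊆ (pairsX n).powersetCard #F.edgeFinset := by
  intro e he
  rw [mem_copyH] at he
  obtain ⟨φ, rfl⟩ := he
  rw [mem_powersetCard]
  exact ⟨copyMap_subset_pairsX n φ, card_copyMap n φ⟩

/-- **Independent sets of `H_n(F)` are `F`-free**: if no copy of `F` lies inside the edge set
`E` of a graph `G` on `Fin n` then `F` is not contained in `G`; contrapositively, a copy of `F`
in `G` (an injective homomorphism) yields a hyperedge inside `E(G)`.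
[cite: NenadovSteger2014, §2 (proof of Thm. 1, 1-statement)] -/
theorem not_isIndep_of_isContained {n : ℕ} (G : _root_.SimpleGraph (Fin n)) [DecidableRel G.Adj]
    (h : F ⊑ G) : ¬ IsIndep (copyH F n) G.edgeFinset := by
  obtain ⟨f⟩ := h
  intro hind
  refine hind (copyMap F n ⟨f, f.injective⟩) (mem_copyH.2 ⟨_, rfl⟩) ?_
  intro x hx
  rw [mem_copyMap] at hx
  obtain ⟨e, he, rfl⟩ := hx
  rw [mem_edgeFinset] at he ⊢
  induction e using Sym2.ind with
  | _ a b =>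
    rw [Function.Embedding.sym2Map_apply, Sym2.map_mk]
    exact f.toHom.map_adj he

/-! ### The vertices touched by a set of pairs -/

/-- The vertices touched by a set `u` of pairs. [folklore] -/
def verts {n : ℕ} (u : Finset (Sym2 (Fin n))) : Finset (Fin n) :=
  univ.filter fun v => ∃ x ∈ u, v ∈ x

/-- Membership in `verts`. [folklore] -/
theorem mem_verts {n : ℕ} {u : Finset (Sym2 (Fin n))} {v : Fin n} :
    v ∈ verts u ↔ ∃ x ∈ u, v ∈ x := by
  simp [verts]

/-- `verts` is monotone. [folklore] -/
theorem verts_mono {n : ℕ} {u u' : Finset (Sym2 (Fin n))} (h : u ⊆ u') : verts u ⊆ verts u' := by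
  intro v hv
  rw [mem_verts] at hv ⊢
  obtain ⟨x, hx, hvx⟩ := hv
  exact ⟨x, h hx, hvx⟩

/-- The vertices of a copy lie in the range of the embedding. [folklore] -/
theorem verts_copyMap_subset {n : ℕ} (φ : Fin k ↪ Fin n) : verts (copyMap F n φ) ⊆ univ.map φ := by
  intro v hv
  rw [mem_verts] at hv
  obtain ⟨x, hx, hvx⟩ := hv
  rw [mem_copyMap] at hx
  obtain ⟨e, -, rfl⟩ := hx
  rw [Function.Embedding.sym2Map_apply, Sym2.mem_map] at hvx
  obtain ⟨a, -, rfl⟩ := hvx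
  exact mem_map_of_mem φ (mem_univ a)

/-- For `F` without isolated vertices, the vertices of a copy ARE the range of the embedding.
[folklore] -/
theorem verts_copyMap_eq {n : ℕ} (hF : ∀ a : Fin k, ∃ b, F.Adj a b) (φ : Fin k ↪ Fin n) :
    verts (copyMap F n φ) = univ.map φ := by
  refine Subset.antisymm (verts_copyMap_subset φ) fun v hv => ?_
  rw [mem_map] at hv
  obtain ⟨a, -, rfl⟩ := hv
  obtain ⟨b, hab⟩ := hF a
  rw [mem_verts]
  refine ⟨φ.sym2Map s(a, b), mem_copyMap.2 ⟨s(a, b), by rwa [mem_edgeFinset], rfl⟩, ?_⟩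
  rw [Function.Embedding.sym2Map_apply, Sym2.map_mk]
  exact Sym2.mem_mk_left _ _

/-! ### At least `C(n, k)` copies -/

/-- **Many copies**: a graph `F` on `Fin k` without isolated vertices has at least `C(n, k)`
copies (as edge sets) in `K_n` — distinct `k`-subsets of vertices carry distinct copies.
[cite: NenadovSteger2014, §2 (proof of Thm. 2: counting copies)] -/
theorem choose_le_card_copyH (hF : ∀ a : Fin k, ∃ b, F.Adj a b) (n : ℕ) :
    n.choose k ≤ #(copyH F n) := by
  classical
  -- the copy sitting on a `k`-set `W`, via its increasing enumeration
  let g : Finset (Fin n) → Finset (Sym2 (Fin n)) := fun W =>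
    if h : #W = k then copyMap F n (W.orderEmbOfFin h).toEmbedding else ∅
  have hg : ∀ W : Finset (Fin n), (hW : #W = k) → g W = copyMap F n (W.orderEmbOfFin hW).toEmbedding :=
    fun W hW => dif_pos hW
  calc n.choose k = #((univ : Finset (Fin n)).powersetCard k) := by
        rw [card_powersetCard, card_univ, Fintype.card_fin]
    _ ≤ #(copyH F n) := by
        refine card_le_card_of_injOn g (fun W hW => ?_) (fun W₁ hW₁ W₂ hW₂ h => ?_)
        · have hWk := (mem_powersetCard.1 (mem_coe.1 hW)).2
          rw [hg W hWk]
          exact mem_coe.2 (mem_copyH.2 ⟨_, rfl⟩)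
        · have h₁ := (mem_powersetCard.1 (mem_coe.1 hW₁)).2
          have h₂ := (mem_powersetCard.1 (mem_coe.1 hW₂)).2
          have hv := congrArg verts h
          rw [hg W₁ h₁, hg W₂ h₂, verts_copyMap_eq hF, verts_copyMap_eq hF] at hv
          have hr : ∀ (W : Finset (Fin n)) (hW : #W = k),
              (univ : Finset (Fin k)).map (W.orderEmbOfFin hW).toEmbedding = W := by
            intro W hW
            ext v
            rw [mem_map]
            constructor
            · rintro ⟨i, -, rfl⟩
              exact W.orderEmbOfFin_mem hW i
            · intro hvW
              have : v ∈ Set.range (W.orderEmbOfFin hW) := by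
                rw [range_orderEmbOfFin]; exact hvW
              obtain ⟨i, hi⟩ := this
              exact ⟨i, mem_univ _, hi⟩
          rwa [hr W₁ h₁, hr W₂ h₂] at hv

/-! ### Co-degrees: copies through a set of pairs -/

/-- Embeddings `Fin k ↪ Fin n` with range inside a fixed set `W` are at most `k!·C(|W|,k)`,
i.e. `|W|.descFactorial k`, in number. [folklore] -/
theorem card_filter_range_subset_le {n : ℕ} (W : Finset (Fin n)) :
    #((univ : Finset (Fin k ↪ Fin n)).filter fun φ => ∀ i, φ i ∈ W) ≤ (#W).descFactorial k := by
  classical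
  have hcard : Fintype.card (Fin k ↪ W) = (#W).descFactorial k := by
    rw [Fintype.card_embedding_eq, Fintype.card_coe, Fintype.card_fin]
  rw [← hcard, ← card_univ]
  -- every such `φ` factors through `W`
  have hsub : ((univ : Finset (Fin k ↪ Fin n)).filter fun φ => ∀ i, φ i ∈ W) ⊆
      (univ : Finset (Fin k ↪ W)).image fun ψ => ψ.trans (Function.Embedding.subtype _) := by
    intro φ hφ
    rw [mem_filter] at hφ
    rw [mem_image]
    refine ⟨φ.codRestrict (W : Set (Fin n)) fun i => hφ.2 i, mem_univ _, ?_⟩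
    ext i
    rfl
  exact (card_le_card hsub).trans card_image_le

/-- **Copies through a set of pairs, crude count**: a set `u` of pairs touching `s` vertices lies
in at most `C(n - s, k - s) · k^k ≤ k^k n^{k-s}` copies of `F` (choose the `k`-set of vertices of
the copy, which must contain the `s` touched vertices, then the embedding onto it).
[cite: NenadovSteger2014, §2 (Cor. 3 proof: "every edge is contained in at most 2e_F n^{v_F-2} copies")] -/
theorem hdeg_copyH_le {n : ℕ} (u : Finset (Sym2 (Fin n))) :
    hdeg (copyH F n) u ≤ k ^ k * n ^ (k - #(verts u)) := by
  classical
  set S := verts u with hS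
  -- copies through `u` ≤ embeddings whose copy contains `u`
  have h1 : hdeg (copyH F n) u ≤ #((univ : Finset (Fin k ↪ Fin n)).filter fun φ => u ⊆ copyMap F n φ) := by
    rw [hdeg, copyH, filter_image]
    exact card_image_le
  -- such embeddings have `S` in their range; group them by the range
  set Ws := ((univ : Finset (Fin n)).powersetCard k).filter fun W => S ⊆ W with hWs
  have h2 : ((univ : Finset (Fin k ↪ Fin n)).filter fun φ => u ⊆ copyMap F n φ) ⊆
      Ws.biUnion fun W => (univ : Finset (Fin k ↪ Fin n)).filter fun φ => ∀ i, φ i ∈ W := by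
    intro φ hφ
    rw [mem_filter] at hφ
    rw [mem_biUnion]
    refine ⟨univ.map φ, ?_, ?_⟩
    · rw [hWs, mem_filter, mem_powersetCard]
      refine ⟨⟨subset_univ _, by rw [card_map, card_univ, Fintype.card_fin]⟩, ?_⟩
      rw [hS]
      exact (verts_mono hφ.2).trans (verts_copyMap_subset φ)
    · rw [mem_filter]
      exact ⟨mem_univ _, fun i => mem_map_of_mem φ (mem_univ i)⟩
  have h3 : #Ws ≤ (n - #S).choose (k - #S) := by
    have := card_filter_powersetCard_superset_le (univ : Finset (Fin n)) S (subset_univ S) k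
    rwa [card_univ, Fintype.card_fin] at this
  calc hdeg (copyH F n) u
      ≤ #((univ : Finset (Fin k ↪ Fin n)).filter fun φ => u ⊆ copyMap F n φ) := h1
    _ ≤ #(Ws.biUnion fun W => (univ : Finset (Fin k ↪ Fin n)).filter fun φ => ∀ i, φ i ∈ W) :=
        card_le_card h2
    _ ≤ ∑ W ∈ Ws, #((univ : Finset (Fin k ↪ Fin n)).filter fun φ => ∀ i, φ i ∈ W) :=
        card_biUnion_le
    _ ≤ ∑ W ∈ Ws, k ^ k := by
        refine sum_le_sum fun W hW => ?_
        have hWk : #W = k := (mem_powersetCard.1 (mem_filter.1 hW).1).2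
        calc _ ≤ (#W).descFactorial k := card_filter_range_subset_le W
          _ ≤ (#W) ^ k := Nat.descFactorial_le_pow _ _
          _ = k ^ k := by rw [hWk]
    _ = #Ws * k ^ k := by rw [sum_const, smul_eq_mul]
    _ ≤ (n - #S).choose (k - #S) * k ^ k := Nat.mul_le_mul_right _ h3
    _ ≤ n ^ (k - #S) * k ^ k := by
        apply Nat.mul_le_mul_right
        exact (Nat.choose_le_pow _ _).trans (Nat.pow_le_pow_left (Nat.sub_le _ _) _)
    _ = k ^ k * n ^ (k - #S) := mul_comm _ _

/-- **Pulling back to `F`: touched vertices versus the 2-density.** If a set `u` of `ℓ ≥ 1`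
pairs of distinct vertices lies in some copy of `F`, then it touches `s ≥ 2 + (ℓ - 1)/m₂(F)`
vertices: the preimages of the touched vertices form a set `U` of `s` vertices of `F` spanning at
least `ℓ` edges, so `m₂(F) ≥ d₂(F[U]) ≥ (ℓ-1)/(s-2)` (and `ℓ = 1`, `s = 2` when `s ≤ 2`).
This is the computation behind the co-degree condition of the container theorem at
`τ = n^{-1/m₂(F)}`. [cite: BaloghMorrisSamotij2019, §3 (the condition on Δ_ℓ, intuition)] -/
theorem le_card_verts {n : ℕ} (hm : 0 < m2Density F) {u : Finset (Sym2 (Fin n))}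
    (hu : u ⊆ pairsX n) (hu1 : 1 ≤ #u) (hdeg1 : 1 ≤ hdeg (copyH F n) u) :
    (2 : ℝ) + (#u - 1) / (m2Density F : ℝ) ≤ #(verts u) := by
  classical
  -- a copy through `u`
  obtain ⟨e, he⟩ : (((copyH F n).filter fun e => u ⊆ e)).Nonempty := by
    rw [← card_pos]; exact hdeg1
  rw [mem_filter, mem_copyH] at he
  obtain ⟨⟨φ, rfl⟩, huφ⟩ := he
  -- the preimage vertex set `U` and edge set `u₀`
  set U : Finset (Fin k) := univ.filter fun a => φ a ∈ verts u with hU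
  set u₀ : Finset (Sym2 (Fin k)) := F.edgeFinset.filter fun e => φ.sym2Map e ∈ u with hu₀
  have hcardU : #U = #(verts u) := by
    refine card_bij (fun a _ => φ a) (fun a ha => (mem_filter.1 ha).2)
      (fun a₁ _ a₂ _ h => φ.injective h) (fun v hv => ?_)
    have hv' := (verts_mono huφ).trans (verts_copyMap_subset φ) hv
    rw [mem_map] at hv'
    obtain ⟨a, -, rfl⟩ := hv'
    exact ⟨a, mem_filter.2 ⟨mem_univ _, hv⟩, rfl⟩
  have hcardu₀ : #u₀ = #u := by
    have : u₀.map φ.sym2Map = u := by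
      ext x
      rw [mem_map]
      constructor
      · rintro ⟨e, he, rfl⟩
        exact (mem_filter.1 he).2
      · intro hx
        obtain ⟨e, he, rfl⟩ := mem_copyMap.1 (huφ hx)
        exact ⟨e, mem_filter.2 ⟨he, hx⟩, rfl⟩
    rw [← this, card_map]
  -- `u₀` consists of edges of `F` inside `U`
  have hu₀sub : u₀ ⊆ U.sym2.filter fun e => e ∈ F.edgeSet := by
    intro e he
    rw [mem_filter] at he
    rw [mem_filter, mem_sym2_iff]
    refine ⟨fun a ha => ?_, mem_edgeFinset.1 he.1⟩
    rw [hU, mem_filter]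
    refine ⟨mem_univ _, mem_verts.2 ⟨φ.sym2Map e, he.2, ?_⟩⟩
    rw [Function.Embedding.sym2Map_apply, Sym2.mem_map]
    exact ⟨a, ha, rfl⟩
  have hℓ : #u ≤ induceEdgeCard F U := by
    rw [← hcardu₀, induceEdgeCard]
    exact card_le_card hu₀sub
  have hm' : (0 : ℝ) < m2Density F := by exact_mod_cast hm
  rcases lt_or_ge #U 3 with hU3 | hU3
  · -- at most two vertices: then `u` is a single pair of two distinct vertices
    have htop : induceEdgeCard F U ≤ (#U).choose 2 := by
      calc induceEdgeCard F U ≤ induceEdgeCard (⊤ : _root_.SimpleGraph (Fin k)) U :=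
            induceEdgeCard_mono le_top U
        _ = (#U).choose 2 := induceEdgeCard_top U
    have hle1 : (#U).choose 2 ≤ 1 := by
      calc (#U).choose 2 ≤ (2 : ℕ).choose 2 := Nat.choose_le_choose 2 (by omega)
        _ = 1 := Nat.choose_self 2
    have hℓ1 : #u = 1 := by omega
    -- the pair has two distinct touched vertices
    obtain ⟨x, hx⟩ := card_eq_one.1 hℓ1
    have hxu : x ∈ u := by rw [hx]; exact mem_singleton_self x
    have hnd : ¬ x.IsDiag := mem_pairsX.1 (hu hxu)
    have h2 : 2 ≤ #(verts u) := by
      induction x using Sym2.ind with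
      | _ a b =>
        rw [Sym2.mk_isDiag_iff] at hnd
        have ha : a ∈ verts u := mem_verts.2 ⟨_, hxu, Sym2.mem_mk_left a b⟩
        have hb : b ∈ verts u := mem_verts.2 ⟨_, hxu, Sym2.mem_mk_right a b⟩
        calc 2 = #{a, b} := (card_pair hnd).symm
          _ ≤ #(verts u) := card_le_card (by
              intro v hv
              simp only [mem_insert, mem_singleton] at hv
              rcases hv with rfl | rfl <;> assumption)
    rw [hℓ1]
    norm_num
    exact_mod_cast h2
  · -- at least three vertices: use the 2-density
    have hd := d2Density_le_m2Density F hU3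
    rw [d2Density] at hd
    have hU3R : (3 : ℚ) ≤ #U := by exact_mod_cast hU3
    have hpos : (0 : ℚ) < (#U : ℚ) - 2 := by linarith
    rw [div_le_iff₀ hpos] at hd
    have hℓQ : (#u : ℚ) ≤ induceEdgeCard F U := by exact_mod_cast hℓ
    -- `(ℓ - 1) ≤ m₂ (s - 2)` over `ℚ`, then over `ℝ`
    have hQ : (#u : ℚ) - 1 ≤ m2Density F * ((#(verts u) : ℚ) - 2) := by
      rw [← hcardU]; linarith
    have hR : (#u : ℝ) - 1 ≤ (m2Density F : ℝ) * ((#(verts u) : ℝ) - 2) := by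
      have := (Rat.cast_le (K := ℝ)).2 hQ
      push_cast at this
      exact this
    rw [← sub_nonneg] at hR ⊢
    have : (#(verts u) : ℝ) - (2 + (#u - 1) / (m2Density F : ℝ)) =
        ((m2Density F : ℝ) * ((#(verts u) : ℝ) - 2) - ((#u : ℝ) - 1)) / (m2Density F : ℝ) := by
      field_simp
      ring
    rw [this]
    positivity

/-- **The co-degree bound of the copy hypergraph via `m₂(F)`** (the verification of the
container condition `Δ_ℓ(H) ≤ c τ^{ℓ-1} e(H)/v(H)` at `τ = n^{-1/m₂(F)}`): for a graph `F` on
`Fin k` with `m₂(F) > 0`, a set `u` of `ℓ ≥ 1` pairs of distinct vertices of `K_n` (`n ≥ 1`) lies in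
at most `k^k · n^{k - 2 - (ℓ - 1)/m₂(F)}` copies of `F`.
[cite: BaloghMorrisSamotij2019, §3 (the condition on Δ_ℓ)] -/
theorem hdeg_copyH_le_rpow {n : ℕ} (hn : 1 ≤ n) (hm : 0 < m2Density F)
    {u : Finset (Sym2 (Fin n))} (hu : u ⊆ pairsX n) (hu1 : 1 ≤ #u) :
    (hdeg (copyH F n) u : ℝ) ≤
      (k : ℝ) ^ k * (n : ℝ) ^ ((k : ℝ) - 2 - ((#u : ℝ) - 1) / (m2Density F : ℝ)) := by
  rcases Nat.eq_zero_or_pos (hdeg (copyH F n) u) with h0 | hpos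
  · rw [h0, Nat.cast_zero]; positivity
  have hs := le_card_verts hm hu hu1 hpos
  have hcrude := hdeg_copyH_le (F := F) u
  -- `s ≤ k`: the touched vertices lie in the range of an embedding of `Fin k`
  have hsk : #(verts u) ≤ k := by
    classical
    obtain ⟨e, he⟩ : (((copyH F n).filter fun e => u ⊆ e)).Nonempty := by
      rw [← card_pos]; exact hpos
    rw [mem_filter, mem_copyH] at he
    obtain ⟨⟨φ, rfl⟩, huφ⟩ := he
    calc #(verts u) ≤ #((univ : Finset (Fin k)).map φ) :=
          card_le_card ((verts_mono huφ).trans (verts_copyMap_subset φ))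
      _ = k := by rw [card_map, card_univ, Fintype.card_fin]
  have hn' : (1 : ℝ) ≤ n := by exact_mod_cast hn
  calc (hdeg (copyH F n) u : ℝ) ≤ (k : ℝ) ^ k * (n : ℝ) ^ ((k - #(verts u) : ℕ) : ℝ) := by
        rw [Real.rpow_natCast]; exact_mod_cast hcrude
    _ ≤ (k : ℝ) ^ k * (n : ℝ) ^ ((k : ℝ) - 2 - ((#u : ℝ) - 1) / (m2Density F : ℝ)) := by
        apply mul_le_mul_of_nonneg_left _ (by positivity)
        apply Real.rpow_le_rpow_of_exponent_le hn'
        rw [Nat.cast_sub hsk]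
        linarith

end Literature.Combinatorics.SimpleGraph
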